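import Summits.QuantumFields.BalabanUV.Beta.EriceFlowEnclosureB12AsPrintedTunedUpper

/-!
# Beta / EriceFlowEnclosureB12AsPrintedPointwise — WHAT (0.31) FORCES POINTWISE, part 1: on [I]'s as-printed carrier, THEOREM 2 + UNIQUENESS OF THE
# TUNED BARE COUPLING («g₀ = g₀(ε, g)» read as a FUNCTION) give the SIGN of β near zero coupling at every scale — the tree's letter `FlowStep.BetaSignH`
# (β-flow team, prover 2 = lower ∕ positivity side, unit `b2b-balaban-beta-bflow-p2`, gen 42; ROW AP-I × ROW U; refines part 1 of the row,
# `…B12AsPrintedLower` §3 («what (0.31)'s left inequality forces: suffix averages, never pointwise») and `FlowStep` §4 (`suffix_lower_not_pointwise`: «the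
# pointwise box bound is a convenient SUFFICIENT form»); part 2 = `…B12AsPrintedPointwiseUniform` (the SIZE under g-uniform constants: `FlowStep.BetaAFH`,
# and Erice's (3.69) at all scales through the dictionary); companions: prover 1's row U `…TunedFlow` (#22: the x-modulus makes tuned runs UNIQUE),
# `…B12AsPrintedHistoryUnique` (gen 33: uniqueness GIVEN the AF letter), and the witness `…B12AsPrintedPointwiseWitness` (gen 42: WITHOUT uniqueness the sign
# is NOT forced))

HONEST FRAMING (page 1 of everything the β sub-cell writes): discharging `BetaPertH` makes Bałaban's UV stability UNCONDITIONAL — a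
real constructive-QFT result; it is NOT the continuum limit and NOT the Clay problem.  HONEST DEPENDENCY (cell reorg 2026-08-19,
verbatim): «continuum YM on T⁴ ⇐ BetaPertH ∧ nine spine estimates (0/9 proved); BetaPertH ⇐ (D1) ∧ (D4) ∧ CAP+tail; G-an2-4 gates
asym, D1 and NE2/3/4.»  THIS MODULE DISCHARGES NOTHING: bookkeeping from the NAMED FIELDS of the statement-exact typing of [I] =
T. Bałaban, Commun. Math. Phys. **109** (1987) [Balaban1987RG1] (`B12BetaAsPrinted`, p537882 ✓ ∕ v1.1 ∕ v1.2: `Definitions`, `Theorem2Statement` —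
Theorem 2 is STATED WITHOUT PROOF in print, p. 259; [Balaban1989LargeFieldII] p. 355 «has not been published yet») under LETTERS that are
HYPOTHESES on an abstract `Setting S`: the Markov letter `hM` (print's NOTATION «β_{k+1}(g_k)», denied by p. 298's text — prover 1's
`…HistoryJumpMarkov`), UNIQUENESS of the in-interval run with given endpoint («g₀ = g₀(ε, g)», p. 259, read as a function — an UNPRINTED reading;
row U), injectivity of the one-step map x ↦ 1∕x² − β_{k+1}(x) on ]0, γ] (supplied by row an4 ∕ I1's k-uniform last-variable clause
`BetaDerivClause.LastVarLipschitz S.β C γ` with row U's smallness Cγ³ < 2 — §3; UNPRINTED uniformity), prover 1's binder `hrg` («inside the box the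
couplings obey (0.20)», dischargeable from (U) by `…TunedUpper.hrg_of_betaUpperH`), an upper bound M.  Nothing of Bałaban's objects is asserted.

THE POINT.  (0.31) bounds the PARTIAL SUMS of β_{j+1}(g₀, …, g_j) FROM THE END of ONE SELECTED run per (ε, g): part 1 of the row showed that this forces
positivity of β only ON AVERAGE along that run (`theorem2Statement_forces_af_steps`; `FlowStep.suffix_lower_not_pointwise`).  But Theorem 2
quantifies over EVERY g ≤ g₁ and EVERY K, and at the LAST step (k = K − 1) the window has length one: `β_K(g₀, …, g_{K−1}) = 1∕g_{K−1}² − 1∕g² ≥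
β ln L > 0` along the tuned run of length K ending at g.  If the tuned run is UNIQUE among the in-interval runs with the same endpoint, every
small-endpoint in-interval run IS a tuned run (§1: uniqueness upgrades Theorem 2's «there exists g₀» to «for all g₀»), and in the Markov reading
with an injective one-step map the points g_{K−1} so reached cover a whole punctured neighbourhood of zero, THE SAME FOR EVERY SCALE (§4): the
SIGN of β_{k+1} near zero coupling is FORCED — `FlowStep` §5's weak located letter `BetaSignH` is an OUTPUT of the printed statement in this regime.
(The SIZE needs (0.31)'s constants uniform in g: part 2.  What separates both from nothing is uniqueness: the companion witness's dip toy has Theorem 2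
with uniform constants, all of [I]'s typed content, Markov β, and β_{k+1} < 0 at couplings → 0.)

WHAT THIS FILE PROVES (0 sorry, 0 def):
§1 **`discrete031_forall_of_unique`** — Theorem 2 + uniqueness of the in-interval run with given (K, m, endpoint) ⟹ (0.31) along EVERY
   in-interval run with endpoint g ≤ g₁ (∃g₀ ↦ ∀g₀); **`lastStep_pos_of_unique`** (+ `hrg`: the LAST β along every such run of length K + 1 is
   ≥ β ln L > 0 — pointwise AT THE RUN'S OWN HISTORY, history reading); `suffixSums_of_unique`.
§2 **`unique_of_markov_injOn`** — Markov + injective one-step maps on ]0, γ] + `hrg` + (0.18) ⟹ uniqueness (backward induction from the endpoint).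
§3 `strictAntiOn_oneStep_of_lipschitz` (|φ x − φ y| ≤ C|x − y| on ]0, γ], Cγ³ < 2 ⟹ x ↦ 1∕x² − φ x strictly antitone), **`injOn_of_lastVarLipschitz`**
   (Markov + `LastVarLipschitz S.β C γ` + Cγ³ < 2 ⟹ the one-step maps are injective at every scale — row U's smallness, sign-free),
   `unique_of_markov_lastVarLipschitz`.
§4 `pointwise_of_tunedRun` (core: one tuned run of length k + 1 through x pins `b₁ ≤ β_{k+1}(x) ≤ b₂`), **`sign_of_theorem2_markov`** (Theorem 2 +
   Markov + bound + injectivity + `hrg` on a box ]0, γ_U] ⟹ ∃ x₁ > 0, β_{k+1}(x) > 0 for ALL k and ALL x ∈ ]0, x₁], indeed in [β(g) ln L, β′(g) ln L] for an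
   endpoint g = g(k, x)), `box_sign_of_theorem2_markov`, **`betaSignH_of_theorem2_markov`** (⟹ `FlowStep.BetaSignH S.β`: THE SIGN LETTER IS NECESSARY),
   **`betaSignH_of_theorem2_lastVarLipschitz`** (inputs: Theorem 2, printed `Definitions`, Markov, `LastVarLipschitz` with Cγ³ < 2, (U) with b′γ² < 1).
NOT CLAIMED: uniqueness, the Markov letter, any modulus, sign or bound for Bałaban's β; Theorem 2; `BetaPertH`; continuum; Clay.
-/

namespace Summit.QuantumFields.BalabanUV.Beta.EriceFlowEnclosureB12AsPrintedPointwise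

open Literature.MathematicalPhysics.QuantumFieldTheory.Balaban1983to89
open Literature.MathematicalPhysics.QuantumFieldTheory.Balaban1983to89.B12BetaAsPrinted
open Literature.MathematicalPhysics.QuantumFieldTheory.Balaban1983to89.FlowStep (prefixOf Box mem_box box_mono BetaContH BetaLowerH
  BetaUpperH BetaSignH BetaAFH RGEqH)
open Literature.MathematicalPhysics.QuantumFieldTheory.Balaban1983to89.BetaDerivClause (LastVarLipschitz)
open Summit.QuantumFields.BalabanUV.Beta.EriceFlowEnclosureB12AsPrintedUpper (tunedRuns_of_theorem2Statement)

noncomputable section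

variable {S : Setting}

/-! ## §1 Uniqueness upgrades Theorem 2's «there exists g₀» to «for all g₀» -/

/-- **(0.31) ALONG EVERY SMALL-ENDPOINT IN-INTERVAL RUN, from Theorem 2 + uniqueness.**  `Theorem2Statement S hL` (verbatim p. 259: *"there exists a
bare coupling constant g₀ = g₀(ε, g) such that the sequence of the effective coupling constants g_k is contained in the interval ]0, γ], and g_K = g.
Moreover, there exist constants β, β′, 0 < β ≦ β′, such that g_k satisfy the inequality (0.31)"*) gives, for every m: γ₀ > 0 and, for γ ∈ ]0, γ₀] such that
THE IN-INTERVAL RUN OF GIVEN LENGTH AND ENDPOINT IS UNIQUE (two runs (K, m, g₀), (K, m, g₀′) inside ]0, γ] with the same g_K have g₀ = g₀′ — «g₀ = g₀(ε, g)»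
read as a function), a threshold g₁ > 0 such that for every g ∈ ]0, g₁] there are 0 < β ≤ β′ with: EVERY run (K, m, g₀) inside ]0, γ] ending at g_K = g
satisfies the per-step (0.31) `Step.Discrete031 (β ln L) (β′ ln L) K g g_·`.  (The tuned run exists by Theorem 2 and is the given one by uniqueness.)
[cite: Balaban1987RG1, Thm 2 (0.31) p.259] -/
theorem discrete031_forall_of_unique {hL : Odd S.L ∧ 1 < S.L} (hT : Theorem2Statement S hL) (m : ℕ) :
    ∃ γ₀ : ℝ, 0 < γ₀ ∧ ∀ γ : ℝ, 0 < γ → γ ≤ γ₀ →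
      (∀ (K : ℕ) (g₀ g₀' : ℝ), Step.InInterval γ K (S.cpl ⟨K, m, g₀⟩) → Step.InInterval γ K (S.cpl ⟨K, m, g₀'⟩) →
          S.cpl ⟨K, m, g₀⟩ K = S.cpl ⟨K, m, g₀'⟩ K → g₀ = g₀') →
      ∃ g₁ : ℝ, 0 < g₁ ∧ ∀ g : ℝ, 0 < g → g ≤ g₁ → ∃ β β' : ℝ, 0 < β ∧ β ≤ β' ∧
        ∀ (K : ℕ) (g₀ : ℝ), Step.InInterval γ K (S.cpl ⟨K, m, g₀⟩) → S.cpl ⟨K, m, g₀⟩ K = g →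
          Step.Discrete031 (β * Real.log S.L) (β' * Real.log S.L) K g (S.cpl ⟨K, m, g₀⟩) := by
  obtain ⟨γ₀, hγ₀, hγ⟩ := tunedRuns_of_theorem2Statement hT m
  refine ⟨γ₀, hγ₀, fun γ hγpos hγle huniq => ?_⟩
  obtain ⟨g₁, hg₁, hg⟩ := hγ γ hγpos hγle
  refine ⟨g₁, hg₁, fun g hgpos hgle => ?_⟩
  obtain ⟨β, β', hβ, hββ', hK⟩ := hg g hgpos hgle
  refine ⟨β, β', hβ, hββ', fun K g₀ hI hend => ?_⟩
  obtain ⟨g₀', hI', hend', hD'⟩ := hK K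
  obtain rfl : g₀ = g₀' := huniq K g₀ g₀' hI hI' (hend.trans hend'.symm)
  exact hD'

/-- **THE LAST β ALONG EVERY SMALL-ENDPOINT RUN IS POSITIVE** (history reading; pointwise AT THE RUN'S OWN HISTORY).  Under Theorem 2, uniqueness on
]0, γ] (γ ≤ γ₀) and prover 1's binder `hrg` (inside ]0, γ] the couplings obey (0.20) at their own histories): there is g₁ > 0 such that along EVERY run
(K + 1, m, g₀) inside ]0, γ] whose endpoint g_{K+1} is ≤ g₁, `β_{K+1}(g₀, …, g_K) = 1∕g_K² − 1∕g_{K+1}² > 0` — indeed ≥ β(g_{K+1})·ln L, (0.31)'s left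
inequality on the window of length one. [cite: Balaban1987RG1, Thm 2 (0.31) p.259 with (0.20) p.256] -/
theorem lastStep_pos_of_unique {hL : Odd S.L ∧ 1 < S.L} (hT : Theorem2Statement S hL) (m : ℕ) :
    ∃ γ₀ : ℝ, 0 < γ₀ ∧ ∀ γ : ℝ, 0 < γ → γ ≤ γ₀ →
      (∀ (K : ℕ) (g₀ g₀' : ℝ), Step.InInterval γ K (S.cpl ⟨K, m, g₀⟩) → Step.InInterval γ K (S.cpl ⟨K, m, g₀'⟩) →
          S.cpl ⟨K, m, g₀⟩ K = S.cpl ⟨K, m, g₀'⟩ K → g₀ = g₀') →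
      (∀ P : B12.RunParams, Step.InInterval γ P.K (S.cpl P) → RGEqH P.K S.β (S.cpl P)) →
      ∃ g₁ : ℝ, 0 < g₁ ∧ ∀ (K : ℕ) (g₀ : ℝ), Step.InInterval γ (K + 1) (S.cpl ⟨K + 1, m, g₀⟩) →
        S.cpl ⟨K + 1, m, g₀⟩ (K + 1) ≤ g₁ → 0 < S.β K (prefixOf (S.cpl ⟨K + 1, m, g₀⟩) K) := by
  have hlog : 0 < Real.log (S.L : ℝ) := Real.log_pos (by exact_mod_cast hL.2)
  obtain ⟨γ₀, hγ₀, hγ⟩ := discrete031_forall_of_unique hT m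
  refine ⟨γ₀, hγ₀, fun γ hγpos hγle huniq hrg => ?_⟩
  obtain ⟨g₁, hg₁, hg⟩ := hγ γ hγpos hγle huniq
  refine ⟨g₁, hg₁, fun K g₀ hI hle => ?_⟩
  set c := S.cpl ⟨K + 1, m, g₀⟩ with hc
  have hgpos : 0 < c (K + 1) := (hI (K + 1) le_rfl).1
  obtain ⟨β, β', hβ, -, hall⟩ := hg (c (K + 1)) hgpos hle
  have hD := hall (K + 1) g₀ hI rfl
  have e : 1 / (c K) ^ 2 = 1 / (c (K + 1)) ^ 2 + S.β K (prefixOf c K) := hrg ⟨K + 1, m, g₀⟩ hI K (Nat.lt_succ_self K)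
  have h1 := (hD K (Nat.le_succ K)).1
  have hone : ((K + 1 : ℕ) : ℝ) - (K : ℝ) = 1 := by push_cast; ring
  rw [hone, mul_one] at h1
  have hβL : 0 < β * Real.log S.L := mul_pos hβ hlog
  linarith

/-- **… AND ALL ITS SUFFIX SUMS ARE AF-SIZED**: along every run (K, m, g₀) inside ]0, γ] with endpoint g ≤ g₁, for every k ≤ K,
`β(g)·ln L·(K − k) ≤ Σ_{j∈[k,K)} β_{j+1}(g₀, …, g_j) ≤ β′(g)·ln L·(K − k)` (the telescoped form of (0.31), `FlowStep.inv_sq_telescopeH`) — part 1's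
suffix-average positivity, now for EVERY small-endpoint run, not only a selected one. [cite: Balaban1987RG1, Thm 2 (0.31) p.259 with (0.20) p.256] -/
theorem suffixSums_of_unique {hL : Odd S.L ∧ 1 < S.L} (hT : Theorem2Statement S hL) (m : ℕ) :
    ∃ γ₀ : ℝ, 0 < γ₀ ∧ ∀ γ : ℝ, 0 < γ → γ ≤ γ₀ →
      (∀ (K : ℕ) (g₀ g₀' : ℝ), Step.InInterval γ K (S.cpl ⟨K, m, g₀⟩) → Step.InInterval γ K (S.cpl ⟨K, m, g₀'⟩) →
          S.cpl ⟨K, m, g₀⟩ K = S.cpl ⟨K, m, g₀'⟩ K → g₀ = g₀') →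
      (∀ P : B12.RunParams, Step.InInterval γ P.K (S.cpl P) → RGEqH P.K S.β (S.cpl P)) →
      ∃ g₁ : ℝ, 0 < g₁ ∧ ∀ g : ℝ, 0 < g → g ≤ g₁ → ∃ β β' : ℝ, 0 < β ∧ β ≤ β' ∧
        ∀ (K : ℕ) (g₀ : ℝ), Step.InInterval γ K (S.cpl ⟨K, m, g₀⟩) → S.cpl ⟨K, m, g₀⟩ K = g → ∀ k, k ≤ K →
          β * Real.log S.L * ((K : ℝ) - k) ≤ ∑ j ∈ Finset.Ico k K, S.β j (prefixOf (S.cpl ⟨K, m, g₀⟩) j) ∧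
            ∑ j ∈ Finset.Ico k K, S.β j (prefixOf (S.cpl ⟨K, m, g₀⟩) j) ≤ β' * Real.log S.L * ((K : ℝ) - k) := by
  obtain ⟨γ₀, hγ₀, hγ⟩ := discrete031_forall_of_unique hT m
  refine ⟨γ₀, hγ₀, fun γ hγpos hγle huniq hrg => ?_⟩
  obtain ⟨g₁, hg₁, hg⟩ := hγ γ hγpos hγle huniq
  refine ⟨g₁, hg₁, fun g hgpos hgle => ?_⟩
  obtain ⟨β, β', hβ, hββ', hall⟩ := hg g hgpos hgle
  refine ⟨β, β', hβ, hββ', fun K g₀ hI hend k hk => ?_⟩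
  have hD := hall K g₀ hI hend k hk
  have htel := FlowStep.inv_sq_telescopeH (hrg ⟨K, m, g₀⟩ hI) hk le_rfl
  rw [hend] at htel
  constructor <;> linarith [hD.1, hD.2]

/-! ## §2 In the Markov reading, injective one-step maps give uniqueness -/

/-- **MARKOV + INJECTIVE ONE-STEP MAPS ⟹ THE IN-INTERVAL RUN WITH GIVEN LENGTH AND ENDPOINT IS UNIQUE.**  If β_{k+1} depends on g_k only (`hM`), each
one-step map x ↦ 1∕x² − β_{k+1}(x) is injective on ]0, γ] (`hinj`; §3 supplies it from row U's modulus), the couplings of every run inside ]0, γ] obey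
(0.20) at their own histories (`hrg`) and (0.18) `d018` holds, then two runs (K, m, g₀), (K, m, g₀′) inside ]0, γ] with the same endpoint g_K coincide —
in particular g₀ = g₀′: backward induction from k = K, each step inverting the injective one-step map. [cite: Balaban1987RG1, Thm 2 p.259 («g₀ = g₀(ε, g)») with (0.18)–(0.20) pp.255–256] -/
theorem unique_of_markov_injOn (hD : Definitions S)
    (hM : ∀ (k : ℕ) (p q : Fin (k + 1) → ℝ), p (Fin.last k) = q (Fin.last k) → S.β k p = S.β k q) {γ : ℝ}
    (hinj : ∀ k : ℕ, Set.InjOn (fun x : ℝ => 1 / x ^ 2 - S.β k (fun _ => x)) (Set.Ioc 0 γ))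
    (hrg : ∀ P : B12.RunParams, Step.InInterval γ P.K (S.cpl P) → RGEqH P.K S.β (S.cpl P))
    (m K : ℕ) (g₀ g₀' : ℝ) (hI : Step.InInterval γ K (S.cpl ⟨K, m, g₀⟩)) (hI' : Step.InInterval γ K (S.cpl ⟨K, m, g₀'⟩))
    (hend : S.cpl ⟨K, m, g₀⟩ K = S.cpl ⟨K, m, g₀'⟩ K) : g₀ = g₀' := by
  have hr := hrg ⟨K, m, g₀⟩ hI
  have hr' := hrg ⟨K, m, g₀'⟩ hI'
  have key : ∀ d k : ℕ, k + d = K → S.cpl ⟨K, m, g₀⟩ k = S.cpl ⟨K, m, g₀'⟩ k := by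
    intro d
    induction d with
    | zero => intro k hk; rw [add_zero] at hk; subst hk; exact hend
    | succ d ih =>
      intro k hk
      have hkK : k < K := by omega
      have hnext : S.cpl ⟨K, m, g₀⟩ (k + 1) = S.cpl ⟨K, m, g₀'⟩ (k + 1) := ih (k + 1) (by omega)
      have e := hr k hkK
      have e' := hr' k hkK
      have hMk : S.β k (prefixOf (S.cpl ⟨K, m, g₀⟩) k) = S.β k (fun _ => S.cpl ⟨K, m, g₀⟩ k) := hM k _ _ rfl
      have hMk' : S.β k (prefixOf (S.cpl ⟨K, m, g₀'⟩) k) = S.β k (fun _ => S.cpl ⟨K, m, g₀'⟩ k) := hM k _ _ rfl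
      refine hinj k ⟨(hI k hkK.le).1, (hI k hkK.le).2⟩ ⟨(hI' k hkK.le).1, (hI' k hkK.le).2⟩ ?_
      show 1 / (S.cpl ⟨K, m, g₀⟩ k) ^ 2 - S.β k (fun _ => S.cpl ⟨K, m, g₀⟩ k) =
        1 / (S.cpl ⟨K, m, g₀'⟩ k) ^ 2 - S.β k (fun _ => S.cpl ⟨K, m, g₀'⟩ k)
      rw [← hMk, ← hMk', ← hnext] at *
      linarith
  have h0 := key K 0 (by simp)
  rw [hD.d018 ⟨K, m, g₀⟩, hD.d018 ⟨K, m, g₀'⟩] at h0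
  exact h0

/-! ## §3 Row U's smallness makes the one-step maps injective (sign-free) -/

/-- **x ↦ 1∕x² − φ(x) IS STRICTLY ANTITONE ON ]0, γ] when |φ x − φ y| ≤ C|x − y| there and Cγ³ < 2**: for x < y in ]0, γ],
`1∕x² − 1∕y² = (y − x)(1∕(x²y) + 1∕(xy²)) ≥ (y − x)·2∕γ³ > C(y − x) ≥ φ x − φ y`.  Row U's smallness (prover 1's #22 `…TunedFlow`: Cγ³ < 2), no
sign of φ. [folklore] -/
theorem strictAntiOn_oneStep_of_lipschitz {φ : ℝ → ℝ} {C γ : ℝ} (hγ : 0 < γ) (hC : C * γ ^ 3 < 2)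
    (hlip : ∀ x y : ℝ, x ∈ Set.Ioc 0 γ → y ∈ Set.Ioc 0 γ → |φ x - φ y| ≤ C * |x - y|) :
    StrictAntiOn (fun x : ℝ => 1 / x ^ 2 - φ x) (Set.Ioc 0 γ) := by
  intro x hx y hy hxy
  have hx0 : 0 < x := hx.1
  have hy0 : 0 < y := hy.1
  have hγ3 : 0 < γ ^ 3 := by positivity
  have hCγ : C < 2 / γ ^ 3 := by rw [lt_div_iff₀ hγ3]; exact hC
  have h1 : 1 / γ ^ 3 ≤ 1 / (x ^ 2 * y) := by
    apply one_div_le_one_div_of_le (by positivity)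
    calc x ^ 2 * y ≤ γ ^ 2 * γ := mul_le_mul (pow_le_pow_left₀ hx0.le hx.2 2) hy.2 hy0.le (by positivity)
      _ = γ ^ 3 := by ring
  have h2 : 1 / γ ^ 3 ≤ 1 / (x * y ^ 2) := by
    apply one_div_le_one_div_of_le (by positivity)
    calc x * y ^ 2 ≤ γ * γ ^ 2 := mul_le_mul hx.2 (pow_le_pow_left₀ hy0.le hy.2 2) (by positivity) hγ.le
      _ = γ ^ 3 := by ring
  have hid : 1 / x ^ 2 - 1 / y ^ 2 = (y - x) * (1 / (x ^ 2 * y) + 1 / (x * y ^ 2)) := by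
    field_simp
    ring
  have hyx : 0 < y - x := by linarith
  have hφ : φ x - φ y ≤ C * (y - x) := by
    have h := hlip x y hx hy
    rw [abs_sub_comm x y, abs_of_pos hyx] at h
    exact (le_abs_self _).trans h
  have htwo : (2 : ℝ) / γ ^ 3 = 1 / γ ^ 3 + 1 / γ ^ 3 := by ring
  have hlow : (y - x) * (2 / γ ^ 3) ≤ 1 / x ^ 2 - 1 / y ^ 2 := by
    rw [hid, htwo]
    exact mul_le_mul_of_nonneg_left (by linarith) hyx.le
  have hstrict : C * (y - x) < (y - x) * (2 / γ ^ 3) := by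
    rw [mul_comm (y - x)]
    exact mul_lt_mul_of_pos_right hCγ hyx
  show 1 / y ^ 2 - φ y < 1 / x ^ 2 - φ x
  linarith

/-- **MARKOV + ROW an4 ∕ I1's k-UNIFORM LAST-VARIABLE CLAUSE WITH ROW U's SMALLNESS ⟹ INJECTIVE ONE-STEP MAPS AT EVERY SCALE.**  Under `hM`, the letter
`BetaDerivClause.LastVarLipschitz S.β C γ` (|β_{k+1}(…, t) − β_{k+1}(…, s)| ≤ C|t − s| on [0, γ], one C for all k — [I] p. 264 prints smoothness in g_j per
scale, the uniformity is UNPRINTED) with Cγ³ < 2 makes every x ↦ 1∕x² − β_{k+1}(x) injective on ]0, γ].  Sign-free. [cite: Balaban1987RG1, p.264 (β-clause after (1.22)) with Thm 2 p.259] -/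
theorem injOn_of_lastVarLipschitz
    (hM : ∀ (k : ℕ) (p q : Fin (k + 1) → ℝ), p (Fin.last k) = q (Fin.last k) → S.β k p = S.β k q) {C γ : ℝ} (hγ : 0 < γ)
    (hLip : LastVarLipschitz S.β C γ) (hC : C * γ ^ 3 < 2) (k : ℕ) :
    Set.InjOn (fun x : ℝ => 1 / x ^ 2 - S.β k (fun _ => x)) (Set.Ioc 0 γ) := by
  refine (strictAntiOn_oneStep_of_lipschitz (φ := fun x => S.β k (fun _ => x)) hγ hC fun x y hx hy => ?_).injOn
  have hp : (fun _ : Fin (k + 1) => γ) ∈ B12Beta.HistBox γ k := fun _ => ⟨hγ, le_rfl⟩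
  have h := hLip k (fun _ => γ) hp y x ⟨hy.1.le, hy.2⟩ ⟨hx.1.le, hx.2⟩
  have ex : S.β k (Function.update (fun _ : Fin (k + 1) => γ) (Fin.last k) x) = S.β k (fun _ => x) :=
    hM k _ _ (by rw [Function.update_self])
  have ey : S.β k (Function.update (fun _ : Fin (k + 1) => γ) (Fin.last k) y) = S.β k (fun _ => y) :=
    hM k _ _ (by rw [Function.update_self])
  rw [ex, ey] at h
  exact h

/-- Hence, in the Markov reading with row U's smallness, «g₀ = g₀(ε, g)» IS a function on the in-interval runs (§2 ∘ §3). [cite: Balaban1987RG1, Thm 2 p.259 («g₀ = g₀(ε, g)») with p.264] -/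
theorem unique_of_markov_lastVarLipschitz (hD : Definitions S)
    (hM : ∀ (k : ℕ) (p q : Fin (k + 1) → ℝ), p (Fin.last k) = q (Fin.last k) → S.β k p = S.β k q) {C γ : ℝ} (hγ : 0 < γ)
    (hLip : LastVarLipschitz S.β C γ) (hC : C * γ ^ 3 < 2)
    (hrg : ∀ P : B12.RunParams, Step.InInterval γ P.K (S.cpl P) → RGEqH P.K S.β (S.cpl P))
    (m K : ℕ) (g₀ g₀' : ℝ) (hI : Step.InInterval γ K (S.cpl ⟨K, m, g₀⟩)) (hI' : Step.InInterval γ K (S.cpl ⟨K, m, g₀'⟩))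
    (hend : S.cpl ⟨K, m, g₀⟩ K = S.cpl ⟨K, m, g₀'⟩ K) : g₀ = g₀' :=
  unique_of_markov_injOn hD hM (injOn_of_lastVarLipschitz hM hγ hLip hC) hrg m K g₀ g₀' hI hI' hend

/-! ## §4 THE SIGN: Theorem 2 + Markov + injectivity force β_{k+1} > 0 on one punctured neighbourhood of zero, at every scale -/

/-- **CORE: ONE TUNED RUN OF LENGTH k + 1 THROUGH x PINS β_{k+1}(x).**  Markov; the one-step map at scale k injective on ]0, γ]; a run (k + 1, m, g₀) inside
]0, γ] ending at g, obeying (0.20), with the per-step two-sided running `Step.Discrete031 b₁ b₂ (k+1) g g_·`; and a point x ∈ ]0, γ] on the same level set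
as the run's g_k (`1∕x² − β_{k+1}(x) = 1∕g²`).  Then g_k = x and (0.31) on the last window reads `b₁ ≤ β_{k+1}(x) ≤ b₂`. [cite: Balaban1987RG1, Thm 2 (0.31) p.259 with (0.20) p.256] -/
theorem pointwise_of_tunedRun
    (hM : ∀ (k : ℕ) (p q : Fin (k + 1) → ℝ), p (Fin.last k) = q (Fin.last k) → S.β k p = S.β k q) {γ : ℝ} {k : ℕ}
    (hinj : Set.InjOn (fun x : ℝ => 1 / x ^ 2 - S.β k (fun _ => x)) (Set.Ioc 0 γ))
    {m : ℕ} {g₀ g b₁ b₂ x : ℝ} (hI : Step.InInterval γ (k + 1) (S.cpl ⟨k + 1, m, g₀⟩)) (hend : S.cpl ⟨k + 1, m, g₀⟩ (k + 1) = g)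
    (hrg : RGEqH (k + 1) S.β (S.cpl ⟨k + 1, m, g₀⟩)) (hD : Step.Discrete031 b₁ b₂ (k + 1) g (S.cpl ⟨k + 1, m, g₀⟩))
    (hx : 0 < x) (hxγ : x ≤ γ) (ht : 1 / x ^ 2 - S.β k (fun _ => x) = 1 / g ^ 2) :
    S.cpl ⟨k + 1, m, g₀⟩ k = x ∧ b₁ ≤ S.β k (fun _ => x) ∧ S.β k (fun _ => x) ≤ b₂ := by
  set c := S.cpl ⟨k + 1, m, g₀⟩ with hc
  have e : 1 / (c k) ^ 2 = 1 / (c (k + 1)) ^ 2 + S.β k (prefixOf c k) := hrg k (Nat.lt_succ_self k)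
  have hMk : S.β k (prefixOf c k) = S.β k (fun _ => c k) := hM k _ _ rfl
  rw [hend, hMk] at e
  have hck : c k = x := by
    refine hinj ⟨(hI k (Nat.le_succ k)).1, (hI k (Nat.le_succ k)).2⟩ ⟨hx, hxγ⟩ ?_
    show 1 / (c k) ^ 2 - S.β k (fun _ => c k) = 1 / x ^ 2 - S.β k (fun _ => x)
    rw [ht]; linarith
  have h := hD k (Nat.le_succ k)
  have hone : ((k + 1 : ℕ) : ℝ) - (k : ℝ) = 1 := by push_cast; ring
  rw [hone, mul_one, mul_one, hck] at h
  rw [hck] at e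
  refine ⟨hck, ?_, ?_⟩ <;> linarith [h.1, h.2]

/-- **THE SIGN OF β NEAR ZERO COUPLING IS FORCED, AT EVERY SCALE, ON ONE NEIGHBOURHOOD.**  Let `Theorem2Statement S hL` hold and let β be Markov (`hM`).  Suppose
that on some box ]0, γ_U]: β_{k+1}(x) ≤ M for all k (an upper bound — print's «uniformly bounded», [I]+[II]'s undisplayed line), every one-step map
x ↦ 1∕x² − β_{k+1}(x) is injective (§3), and the couplings of every run inside ]0, γ_U] obey (0.20) (`hrg`).  Then there is x₁ > 0 (x₁ ≤ γ_U) with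
**β_{k+1}(x) > 0 for EVERY k and EVERY x ∈ ]0, x₁]**.  Proof: with γ := min(γ_U, γ₀) and Theorem 2's g₁ = g₁(γ), take 1∕x₁² ≥ 1∕g₁² + M⁺; for x ≤ x₁ the
target t := 1∕x² − β_{k+1}(x) is ≥ 1∕g₁², so g := t^{−1∕2} ≤ g₁ is an admissible endpoint; Theorem 2's run of length k + 1 ending at g passes, at step k,
through THE preimage of t — which is x — and (0.31) on the last window gives β_{k+1}(x) ≥ β(g) ln L > 0 (`pointwise_of_tunedRun`).  Contrast part 1 §3
∕ `FlowStep.suffix_lower_not_pointwise`: without uniqueness only suffix AVERAGES are forced (and the companion witness shows the sign can then fail).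
[cite: Balaban1987RG1, Thm 2 (0.31) p.259 with (0.20) p.256 and p.264 («uniformly bounded»)] -/
theorem sign_of_theorem2_markov {hL : Odd S.L ∧ 1 < S.L} (hT : Theorem2Statement S hL)
    (hM : ∀ (k : ℕ) (p q : Fin (k + 1) → ℝ), p (Fin.last k) = q (Fin.last k) → S.β k p = S.β k q) {γU M : ℝ} (hγU : 0 < γU)
    (hub : ∀ (k : ℕ) (x : ℝ), 0 < x → x ≤ γU → S.β k (fun _ => x) ≤ M)
    (hinj : ∀ k : ℕ, Set.InjOn (fun x : ℝ => 1 / x ^ 2 - S.β k (fun _ => x)) (Set.Ioc 0 γU))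
    (hrg : ∀ P : B12.RunParams, Step.InInterval γU P.K (S.cpl P) → RGEqH P.K S.β (S.cpl P)) (m : ℕ) :
    ∃ x₁ : ℝ, 0 < x₁ ∧ x₁ ≤ γU ∧ ∀ (k : ℕ) (x : ℝ), 0 < x → x ≤ x₁ →
      ∃ g β β' : ℝ, 0 < g ∧ 0 < β ∧ β ≤ β' ∧
        β * Real.log S.L ≤ S.β k (fun _ => x) ∧ S.β k (fun _ => x) ≤ β' * Real.log S.L ∧ 0 < S.β k (fun _ => x) := by
  have hlog : 0 < Real.log (S.L : ℝ) := Real.log_pos (by exact_mod_cast hL.2)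
  obtain ⟨γ₀, hγ₀, hγ⟩ := tunedRuns_of_theorem2Statement hT m
  set γ := min γU γ₀ with hγdef
  have hγpos : 0 < γ := lt_min hγU hγ₀
  have hγle : γ ≤ γ₀ := min_le_right _ _
  have hγU' : γ ≤ γU := min_le_left _ _
  obtain ⟨g₁, hg₁, hg⟩ := hγ γ hγpos hγle
  set A : ℝ := 1 / g₁ ^ 2 + max M 0 with hA
  have hApos : 0 < A := by positivity
  set x₁ : ℝ := min γ (1 / Real.sqrt A) with hx₁
  have hx₁pos : 0 < x₁ := lt_min hγpos (by positivity)
  refine ⟨x₁, hx₁pos, (min_le_left _ _).trans hγU', fun k x hx hxle => ?_⟩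
  have hxγ : x ≤ γ := hxle.trans (min_le_left _ _)
  have hxγU : x ≤ γU := hxγ.trans hγU'
  -- 1/x² ≥ A
  have hx2 : x ^ 2 ≤ 1 / A := by
    calc x ^ 2 ≤ (1 / Real.sqrt A) ^ 2 := pow_le_pow_left₀ hx.le (hxle.trans (min_le_right _ _)) 2
      _ = 1 / A := by rw [div_pow, one_pow, Real.sq_sqrt hApos.le]
  have hxA : A ≤ 1 / x ^ 2 := by rw [le_one_div hApos (by positivity)]; exact hx2
  -- the target level and the endpoint
  set t : ℝ := 1 / x ^ 2 - S.β k (fun _ => x) with ht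
  have hφM : S.β k (fun _ => x) ≤ M := hub k x hx hxγU
  have htg₁ : 1 / g₁ ^ 2 ≤ t := by
    have : M ≤ max M 0 := le_max_left _ _
    rw [ht, hA] at *; linarith
  have htpos : 0 < t := lt_of_lt_of_le (by positivity) htg₁
  set g : ℝ := 1 / Real.sqrt t with hgdef
  have hgpos : 0 < g := by positivity
  have hg2 : 1 / g ^ 2 = t := by rw [hgdef, div_pow, one_pow, Real.sq_sqrt htpos.le, one_div_one_div]
  have hgle : g ≤ g₁ := by
    have h1 : 1 / g₁ ≤ Real.sqrt t := by
      have := Real.sqrt_le_sqrt htg₁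
      rwa [show (1 : ℝ) / g₁ ^ 2 = (1 / g₁) ^ 2 by ring, Real.sqrt_sq (by positivity)] at this
    calc g = 1 / Real.sqrt t := rfl
      _ ≤ 1 / (1 / g₁) := one_div_le_one_div_of_le (by positivity) h1
      _ = g₁ := one_div_one_div g₁
  obtain ⟨β, β', hβ, hββ', hK⟩ := hg g hgpos hgle
  obtain ⟨g₀, hI, hend, hD⟩ := hK (k + 1)
  have hIU : Step.InInterval γU (k + 1) (S.cpl ⟨k + 1, m, g₀⟩) := fun i hi => ⟨(hI i hi).1, (hI i hi).2.trans hγU'⟩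
  obtain ⟨-, hlo, hhi⟩ := pointwise_of_tunedRun hM (hinj k) hIU hend (hrg ⟨k + 1, m, g₀⟩ hIU) hD hx hxγU (by rw [hg2])
  exact ⟨g, β, β', hgpos, hβ, hββ', hlo, hhi, lt_of_lt_of_le (mul_pos hβ hlog) hlo⟩

/-- **… ON THE BOXES**: under the same letters there is x₁ > 0 with `β_{k+1}(g₀, …, g_k) > 0` for every k and EVERY history in ]0, x₁]^{k+1} (Markov: the value
depends on g_k ∈ ]0, x₁] only). [cite: Balaban1987RG1, Thm 2 (0.31) p.259 with (0.20) p.256] -/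
theorem box_sign_of_theorem2_markov {hL : Odd S.L ∧ 1 < S.L} (hT : Theorem2Statement S hL)
    (hM : ∀ (k : ℕ) (p q : Fin (k + 1) → ℝ), p (Fin.last k) = q (Fin.last k) → S.β k p = S.β k q) {γU M : ℝ} (hγU : 0 < γU)
    (hub : ∀ (k : ℕ) (x : ℝ), 0 < x → x ≤ γU → S.β k (fun _ => x) ≤ M)
    (hinj : ∀ k : ℕ, Set.InjOn (fun x : ℝ => 1 / x ^ 2 - S.β k (fun _ => x)) (Set.Ioc 0 γU))
    (hrg : ∀ P : B12.RunParams, Step.InInterval γU P.K (S.cpl P) → RGEqH P.K S.β (S.cpl P)) :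
    ∃ x₁ : ℝ, 0 < x₁ ∧ x₁ ≤ γU ∧ ∀ (k : ℕ) (v : Fin (k + 1) → ℝ), v ∈ Box x₁ k → 0 < S.β k v := by
  obtain ⟨x₁, hx₁, hx₁U, h⟩ := sign_of_theorem2_markov hT hM hγU hub hinj hrg 0
  refine ⟨x₁, hx₁, hx₁U, fun k v hv => ?_⟩
  have hlast := (mem_box.1 hv) (Fin.last k)
  obtain ⟨-, -, -, -, -, -, -, -, hpos⟩ := h k (v (Fin.last k)) hlast.1 hlast.2
  rwa [hM k v (fun _ => v (Fin.last k)) rfl]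

/-- **THE SIGN LETTER `FlowStep.BetaSignH` IS NECESSARY** (in the Markov reading with injective one-step maps): Theorem 2 AS TYPED + `hM` + an upper bound +
injectivity + `hrg` on some box ]0, γ_U] ⟹ `BetaSignH S.β` (β_{k+1} ≥ 0 — indeed > 0 — on ]0, x₁]^{k+1} for all k).  `FlowStep` §5 lists `BetaSignH` as the
WEAK located unprinted input («suffices … for the bare coupling g₀(ε, g) and the interval hypothesis»); here it is an OUTPUT of the printed statement once
«g₀ = g₀(ε, g)» is a function. [cite: Balaban1987RG1, Thm 2 (0.31) p.259 and p.264 («other properties in a separate paper»)] -/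
theorem betaSignH_of_theorem2_markov {hL : Odd S.L ∧ 1 < S.L} (hT : Theorem2Statement S hL)
    (hM : ∀ (k : ℕ) (p q : Fin (k + 1) → ℝ), p (Fin.last k) = q (Fin.last k) → S.β k p = S.β k q) {γU M : ℝ} (hγU : 0 < γU)
    (hub : ∀ (k : ℕ) (x : ℝ), 0 < x → x ≤ γU → S.β k (fun _ => x) ≤ M)
    (hinj : ∀ k : ℕ, Set.InjOn (fun x : ℝ => 1 / x ^ 2 - S.β k (fun _ => x)) (Set.Ioc 0 γU))
    (hrg : ∀ P : B12.RunParams, Step.InInterval γU P.K (S.cpl P) → RGEqH P.K S.β (S.cpl P)) : BetaSignH S.β := by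
  obtain ⟨x₁, hx₁, -, h⟩ := box_sign_of_theorem2_markov hT hM hγU hub hinj hrg
  exact ⟨x₁, hx₁, fun k v hv => (h k v hv).le⟩

/-- **… WITH ROW U's MODULUS AS THE ONLY STRUCTURAL INPUT**: Theorem 2 + printed `Definitions` + Markov + `LastVarLipschitz S.β C γ_U` with Cγ_U³ < 2 + (U)
`BetaUpperH b′ γ_U S.β` with b′γ_U² < 1 (which gives `hrg` by prover 1's `hrg_of_betaUpperH`) ⟹ `BetaSignH S.β`. [cite: Balaban1987RG1, Thm 2 (0.31) p.259 with (0.20) p.256 and p.264] -/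
theorem betaSignH_of_theorem2_lastVarLipschitz (hH : StandingHypotheses S) (hD : Definitions S)
    (hT : Theorem2Statement S (hL_of_standing hH))
    (hM : ∀ (k : ℕ) (p q : Fin (k + 1) → ℝ), p (Fin.last k) = q (Fin.last k) → S.β k p = S.β k q) {C γU b' : ℝ} (hγU : 0 < γU)
    (hLip : LastVarLipschitz S.β C γU) (hC : C * γU ^ 3 < 2) (hup : BetaUpperH b' γU S.β) (hsmall : b' * γU ^ 2 < 1) :
    BetaSignH S.β := by
  refine betaSignH_of_theorem2_markov hT hM hγU (M := b') (fun k x hx hxle => hup k _ (mem_box.2 fun _ => ⟨hx, hxle⟩))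
    (injOn_of_lastVarLipschitz hM hγU hLip hC) fun P hI => ?_
  exact EriceFlowEnclosureB12AsPrintedTunedUpper.hrg_of_betaUpperH hD hγU hup hsmall P hI

end

end Summit.QuantumFields.BalabanUV.Beta.EriceFlowEnclosureB12AsPrintedPointwise
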